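import Mathlib
import HarnessLib
import HarnessLib.Audit
import Summits.ValiantsHypothesis.ValiantsHypothesis.Theorems.LacunarySymmetroidMatrixDescartesZeroChangeValleyDipBudget

/-!
# ValiantsHypothesis / LacunarySymmetroid — crux `MatrixDescartes` (stmt-ValiantsHypothesis-18050, V1), LINE (A) «product_plus_one»,
# research stubs `stub_classRowK3` / `stub_eulerBoundK3`, valley residue: EVERY DIP SITS IN THE CORE OF A VALLEY ROW

Fifth panel of the valley-residue series (✓ `…ZeroChangeValleyBottoms`, ✓ `…EulerMiddleOuterRatio`, ✓ `…EulerTopBottomRatio`,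
✓ `…ZeroChangeValleyDipBudget`).  The dip budget `posCrit Φ ≤ 2·#DIPS + 1` of a zero-free company leaves the count `#DIPS ≤ m` (located,
not proved).  This file localises the dips ROW BY ROW: by the dip criterion `Σ_j (t g_j′/g_j)² ≤ a(a−c)·M(t) = Σ_j a(a−c)a_{j1}t^a/g_j`
(✓ `dip_iff_sq_sum_le`) and pigeonhole, at every dip `t` SOME row `j` satisfies the CORE INEQUALITY
  `(t·g_j′(t))² ≤ a(a−c)·a_{j1}·t^a·g_j(t)`,
which forces `a_{j1} < 0` (the row is a genuine VALLEY, never a zero-change row) and says that `t` is close to that row's bottom `τ_j` in the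
row's own scale: `t^a·β_j(t)² ≤ a(c−a)|a_{j1}|·g_j(t)` with the bottom bracket `β_j(t) = a·a_{j1} + c·a_{j2}t^{c−a}` (`β_j(τ_j) = 0`).

* `exists_le_of_sum_sq_le_middleSum` — pigeonhole form of the dip criterion;
* ★ `exists_coreRow_of_dip` — zero-free company, `t > 0` critical with `Φ(t)Φ″(t) ≥ 0` ⇒ ∃ row in its core at `t`;
* `valley_of_core` — a row with positive top letter in its core at `t > 0` has a NEGATIVE middle letter;
* ★ `exists_valley_core_bracket_of_dip` — bracket form: ∃ `j` with `a_{j1} < 0` and `t^a·(a·a_{j1} + c·a_{j2}t^{c−a})² ≤ a(c−a)(−a_{j1})·g_j(t)`;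
* `no_dip_of_zeroChange_company` — corollary: a zero-free company of ZERO-CHANGE rows (`a_{j1} ≥ 0`, `a_{j2} > 0`) has no dip at all, hence
  (`posCrit ≤ 2·0 + 1`) at most one positive critical point — the classical log-convexity count, recovered from the dip budget.

LOCATED (seat numerics, see ✓ `…ValleyDipBudget` header): `#DIPS ≤ m`; natural sharpening suggested by this file: an injection
dips → valley rows through the cores.  OPEN.

HONEST FRAMING: helper theorems, def-free, no named facts, no `sorry`, standard axioms; closes NO stub by name; `OneChangeFloorK3`,
`EulerBoundK3`, `ClassRowK3Linear`, `PPOPolyLaw`, `MatrixDescartes` (stmt-ValiantsHypothesis-18050) stay OPEN; `VP ≠ VNP` is NOT proved and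
nothing here bears on it.  [folklore] Pigeonhole and elementary algebra; no citation needed.
-/

set_option linter.dupNamespace false

namespace Summit.ValiantsHypothesis.ValiantsHypothesis.Theorems.LacunarySymmetroidMatrixDescartes

namespace ZeroChange

open Polynomial Finset

/-- Pigeonhole form of the dip criterion: if `Σ_j (t g_j′/g_j)² ≤ a(a−c)·M(t)` and `m ≥ 1`, some row has
`(t g_j′/g_j)² ≤ a(a−c)·a_{j1}t^a/g_j`. [folklore] -/
theorem exists_le_of_sum_sq_le_middleSum (m a c : ℕ) (hm : 0 < m) (co : Fin m → ℝ × ℝ × ℝ) {t : ℝ}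
    (h : ∑ j, (t * (derivative (row a c (co j).1 (co j).2.1 (co j).2.2)).eval t /
        (row a c (co j).1 (co j).2.1 (co j).2.2).eval t) ^ 2 ≤ (a : ℝ) * ((a : ℝ) - c) * middleSum a c co t) :
    ∃ j, (t * (derivative (row a c (co j).1 (co j).2.1 (co j).2.2)).eval t /
        (row a c (co j).1 (co j).2.1 (co j).2.2).eval t) ^ 2 ≤
      (a : ℝ) * ((a : ℝ) - c) * ((co j).2.1 * t ^ a / (row a c (co j).1 (co j).2.1 (co j).2.2).eval t) := by
  classical
  rw [middleSum, mul_sum] at h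
  haveI : Nonempty (Fin m) := ⟨⟨0, hm⟩⟩
  obtain ⟨j, -, hj⟩ := exists_le_of_sum_le univ_nonempty h
  exact ⟨j, hj⟩

/-- ★ **EVERY DIP SITS IN THE CORE OF A ROW**: zero-free company, `t > 0` a critical point with `Φ(t)Φ″(t) ≥ 0` (a dip), `m ≥ 1` ⇒
some row satisfies `(t g_j′(t))² ≤ a(a−c)·a_{j1}·t^a·g_j(t)`. [folklore] -/
theorem exists_coreRow_of_dip (m a c : ℕ) (hm : 0 < m) (co : Fin m → ℝ × ℝ × ℝ)
    (hpos : ∀ j, ∀ t : ℝ, 0 < t → 0 < (row a c (co j).1 (co j).2.1 (co j).2.2).eval t) {t : ℝ} (ht : 0 < t)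
    (hcrit : (derivative (∏ j, row a c (co j).1 (co j).2.1 (co j).2.2)).eval t = 0)
    (hdip : 0 ≤ (∏ j, row a c (co j).1 (co j).2.1 (co j).2.2).eval t *
      (derivative (derivative (∏ j, row a c (co j).1 (co j).2.1 (co j).2.2))).eval t) :
    ∃ j, (t * (derivative (row a c (co j).1 (co j).2.1 (co j).2.2)).eval t) ^ 2 ≤
      (a : ℝ) * ((a : ℝ) - c) * (co j).2.1 * t ^ a * (row a c (co j).1 (co j).2.1 (co j).2.2).eval t := by
  classical
  have hΦ : (∏ j, row a c (co j).1 (co j).2.1 (co j).2.2).eval t ≠ 0 := by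
    rw [eval_prod]
    exact (prod_pos fun j _ => hpos j t ht).ne'
  have hsum := (dip_iff_sq_sum_le m a c co ht hΦ hcrit).1 hdip
  obtain ⟨j, hj⟩ := exists_le_of_sum_sq_le_middleSum m a c hm co hsum
  refine ⟨j, ?_⟩
  have hg := hpos j t ht
  rw [div_pow, div_le_iff₀ (pow_pos hg 2)] at hj
  have e : (a : ℝ) * ((a : ℝ) - c) * ((co j).2.1 * t ^ a / (row a c (co j).1 (co j).2.1 (co j).2.2).eval t) *
      (row a c (co j).1 (co j).2.1 (co j).2.2).eval t ^ 2
      = (a : ℝ) * ((a : ℝ) - c) * (co j).2.1 * t ^ a * (row a c (co j).1 (co j).2.1 (co j).2.2).eval t := by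
    field_simp
  linarith [hj, e]

/-- **A row in its core is a valley**: if `(t g′(t))² ≤ a(a−c)·a₁·t^a·g(t)` with `g(t) > 0`, `t > 0`, `a < c` and positive top letter
`a₂ > 0`, then `a₁ < 0`. [folklore] -/
theorem valley_of_core (a c : ℕ) (hac : a < c) (a₀ a₁ a₂ : ℝ) (ha₂ : 0 < a₂) {t : ℝ} (ht : 0 < t)
    (hg : 0 < (row a c a₀ a₁ a₂).eval t)
    (hcore : (t * (derivative (row a c a₀ a₁ a₂)).eval t) ^ 2 ≤ (a : ℝ) * ((a : ℝ) - c) * a₁ * t ^ a * (row a c a₀ a₁ a₂).eval t) :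
    a₁ < 0 := by
  by_contra hge
  push Not at hge
  have hac' : (a : ℝ) - c < 0 := by
    have : (a : ℝ) < c := by exact_mod_cast hac
    linarith
  have ha : (0 : ℝ) ≤ a := Nat.cast_nonneg a
  have hta : 0 < t ^ a := pow_pos ht a
  -- the right side is ≤ 0, so `t g′(t) = 0`
  have hrhs : (a : ℝ) * ((a : ℝ) - c) * a₁ * t ^ a * (row a c a₀ a₁ a₂).eval t ≤ 0 := by
    have h1 : (a : ℝ) * ((a : ℝ) - c) * a₁ ≤ 0 := by
      have : (a : ℝ) * ((a : ℝ) - c) ≤ 0 := mul_nonpos_of_nonneg_of_nonpos ha hac'.le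
      exact mul_nonpos_of_nonpos_of_nonneg this hge
    have h2 := mul_nonpos_of_nonpos_of_nonneg h1 hta.le
    exact mul_nonpos_of_nonpos_of_nonneg h2 hg.le
  have hzero : t * (derivative (row a c a₀ a₁ a₂)).eval t = 0 := by
    have hsq : (t * (derivative (row a c a₀ a₁ a₂)).eval t) ^ 2 ≤ 0 := hcore.trans hrhs
    exact pow_eq_zero_iff (two_ne_zero) |>.1 (le_antisymm hsq (sq_nonneg _))
  rw [mul_eval_derivative_row] at hzero
  have hc : (0 : ℝ) < c := by exact_mod_cast (lt_of_le_of_lt (Nat.zero_le a) hac)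
  have hpos : 0 < (a : ℝ) * a₁ * t ^ a + (c : ℝ) * a₂ * t ^ c := by
    have h1 : 0 ≤ (a : ℝ) * a₁ * t ^ a := mul_nonneg (mul_nonneg ha hge) hta.le
    have h2 : 0 < (c : ℝ) * a₂ * t ^ c := mul_pos (mul_pos hc ha₂) (pow_pos ht c)
    linarith
  exact hpos.ne' hzero

/-- ★ **BRACKET FORM OF THE DIP CORE**: zero-free company with positive top letters, `t > 0` a dip, `m ≥ 1` ⇒ there is a VALLEY row `j`
(`a_{j1} < 0`) with `t^a·(a·a_{j1} + c·a_{j2}·t^{c−a})² ≤ a(c−a)·(−a_{j1})·g_j(t)` — `t` is near that row's bottom in the row's own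
scale (the left side vanishes exactly at the bottom). [folklore] -/
theorem exists_valley_core_bracket_of_dip (m a c : ℕ) (hac : a < c) (hm : 0 < m) (co : Fin m → ℝ × ℝ × ℝ)
    (htop : ∀ j, 0 < (co j).2.2)
    (hpos : ∀ j, ∀ t : ℝ, 0 < t → 0 < (row a c (co j).1 (co j).2.1 (co j).2.2).eval t) {t : ℝ} (ht : 0 < t)
    (hcrit : (derivative (∏ j, row a c (co j).1 (co j).2.1 (co j).2.2)).eval t = 0)
    (hdip : 0 ≤ (∏ j, row a c (co j).1 (co j).2.1 (co j).2.2).eval t *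
      (derivative (derivative (∏ j, row a c (co j).1 (co j).2.1 (co j).2.2))).eval t) :
    ∃ j, (co j).2.1 < 0 ∧
      t ^ a * ((a : ℝ) * (co j).2.1 + (c : ℝ) * (co j).2.2 * t ^ (c - a)) ^ 2 ≤
        (a : ℝ) * ((c : ℝ) - a) * (-(co j).2.1) * (row a c (co j).1 (co j).2.1 (co j).2.2).eval t := by
  obtain ⟨j, hj⟩ := exists_coreRow_of_dip m a c hm co hpos ht hcrit hdip
  refine ⟨j, valley_of_core a c hac _ _ _ (htop j) ht (hpos j t ht) hj, ?_⟩
  have hbr := mul_eval_derivative_row_eq_bracket a c hac.le (co j).1 (co j).2.1 (co j).2.2 t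
  rw [hbr] at hj
  have hta : 0 < t ^ a := pow_pos ht a
  -- `(t^a β)² ≤ a(a−c) q t^a g` ⇒ `t^a β² ≤ a(c−a)(−q) g`
  have h1 : t ^ a * (t ^ a * ((a : ℝ) * (co j).2.1 + (c : ℝ) * (co j).2.2 * t ^ (c - a)) ^ 2) ≤
      t ^ a * ((a : ℝ) * ((c : ℝ) - a) * (-(co j).2.1) * (row a c (co j).1 (co j).2.1 (co j).2.2).eval t) := by
    have e1 : (t ^ a * ((a : ℝ) * (co j).2.1 + (c : ℝ) * (co j).2.2 * t ^ (c - a))) ^ 2 =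
        t ^ a * (t ^ a * ((a : ℝ) * (co j).2.1 + (c : ℝ) * (co j).2.2 * t ^ (c - a)) ^ 2) := by ring
    have e2 : (a : ℝ) * ((a : ℝ) - c) * (co j).2.1 * t ^ a * (row a c (co j).1 (co j).2.1 (co j).2.2).eval t =
        t ^ a * ((a : ℝ) * ((c : ℝ) - a) * (-(co j).2.1) * (row a c (co j).1 (co j).2.1 (co j).2.2).eval t) := by ring
    rw [← e1, ← e2]
    exact hj
  exact le_of_mul_le_mul_left h1 hta

/-- **Zero-change companies have no dip**: if every row has `a_{j1} ≥ 0`, `a_{j2} > 0` and is positive on `(0,∞)`, then no positive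
critical point of `Φ` is a dip; with the dip budget, `posCrit Φ ≤ 1`. [folklore] -/
theorem no_dip_of_zeroChange_company (m a c : ℕ) (hac : a < c) (co : Fin m → ℝ × ℝ × ℝ)
    (hmid : ∀ j, 0 ≤ (co j).2.1) (htop : ∀ j, 0 < (co j).2.2)
    (hpos : ∀ j, ∀ t : ℝ, 0 < t → 0 < (row a c (co j).1 (co j).2.1 (co j).2.2).eval t) :
    posCrit (∏ j, row a c (co j).1 (co j).2.1 (co j).2.2) ≤ 1 := by
  classical
  rcases Nat.eq_zero_or_pos m with rfl | hm
  · simp [posCrit]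
  have hbudget := posCrit_le_two_mul_dips_add_one_of_zeroFree m a c co hpos
  have hempty : (((derivative (∏ j, row a c (co j).1 (co j).2.1 (co j).2.2)).roots.toFinset.filter (fun t => 0 < t)).filter
      (fun t => 0 ≤ (∏ j, row a c (co j).1 (co j).2.1 (co j).2.2).eval t *
        (derivative (derivative (∏ j, row a c (co j).1 (co j).2.1 (co j).2.2))).eval t)) = ∅ := by
    refine filter_false_of_mem fun t ht => ?_
    simp only [mem_filter, Multiset.mem_toFinset] at ht
    obtain ⟨hroot, ht0⟩ := ht
    intro hdip
    have hcrit : (derivative (∏ j, row a c (co j).1 (co j).2.1 (co j).2.2)).eval t = 0 := (mem_roots'.1 hroot).2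
    obtain ⟨j, hjneg, -⟩ := exists_valley_core_bracket_of_dip m a c hac hm co htop hpos ht0 hcrit hdip
    exact absurd (hmid j) (not_le.2 hjneg)
  rw [hempty, card_empty, mul_zero, zero_add] at hbudget
  exact hbudget

end ZeroChange

end Summit.ValiantsHypothesis.ValiantsHypothesis.Theorems.LacunarySymmetroidMatrixDescartes
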